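import Mathlib.Analysis.SpecialFunctions.Complex.Log
import Mathlib.Analysis.Complex.Cardinality
import Mathlib.RingTheory.Algebraic.Basic
import Literature.NumberTheory.Transcendental.ExpAlgebraicNumbers
import Literature.NumberTheory.Transcendental.ZilberFieldCCP
import HarnessLib

/-!
# Exponentially algebraic numbers: `E = ecl (∅ : Set ℂ)` and the closure API (proofs)

Sibling proof file of `ExpAlgebraicNumbers.lean` (which defines, with Mathlib imports only,
`Literature.NumberTheory.Transcendental.IsExpAlgebraic` and `expAlgebraicNumbers`). Here we import
the tree's theory of Kirby's exponential-algebraic closure `ecl` (`ZilberField.lean`,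
`EclPregeometryProofs.lean`, `EclClosureOperatorProofs.lean`, `ZilberFieldCCP.lean`) and prove:

* the BRIDGE `isExpAlgebraic_iff_mem_ecl_empty : IsExpAlgebraic a ↔ a ∈ ecl (∅ : Set ℂ)` and
  `expAlgebraicNumbers_eq_ecl_empty : expAlgebraicNumbers = ecl (∅ : Set ℂ)` (the two definitions
  differ only by `Subring.closure ∅ = ⊥ = range (Int.cast)` — `Subring.closure_empty`,
  `Subring.mem_bot` — and by the `rfl`s `ExponentialRing.exp = Complex.exp` on `ℂ`,
  `expPDeriv j f = pderiv (inl j) f + X (inr j) * pderiv (inr j) f`);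
* `E` is `ecl`-closed (`ecl_expAlgebraicNumbers`, Kirby Lemma 3.3 idempotence);
* `E` is (the carrier of) the subfield `Khovanskii.eclSubfield ∅` of `ℂ` (`coe_eclSubfield_empty`,
  `mem_eclSubfield_empty_iff`; dot-notation closure lemmas
  `IsExpAlgebraic.add/neg/sub/mul/inv/div/pow/zpow`, `isExpAlgebraic_ratCast`) closed under `exp`
  (`IsExpAlgebraic.exp`) and under logarithms (`IsExpAlgebraic.of_exp`, `IsExpAlgebraic.log`),
  relatively algebraically closed in `ℂ` (`IsExpAlgebraic.of_isRoot`), hence containing every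
  algebraic number (`IsExpAlgebraic.of_isAlgebraic`) — Kirby 2010 Lemma 3.3 and §7;
* the classical constants: `πi`, `i`, `π`, `e`, `log α` for algebraic `α` lie in `E`
  (`isExpAlgebraic_pi_mul_I`, `isExpAlgebraic_I`, `isExpAlgebraic_pi`, `isExpAlgebraic_exp_one`,
  `isExpAlgebraic_log_of_isAlgebraic`) and the four classical open pairs of Schanuel's conjecture
  are pairs from `E` (`isExpAlgebraic_classicalPairs`);
* `E` is countable (`countable_expAlgebraicNumbers`, Kirby Remark 3.4 / Zilber 2005 Lemma 5.12, from
  the tree's `hasCountableClosureProperty_complex_holds`), so exponentially transcendental numbers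
  exist (`exists_not_isExpAlgebraic`).

Everything is proved; the file declares theorems only (no definitions, no named facts). The
corresponding statements for `ecl C` with arbitrary `C` are the tree's `Khovanskii.*_mem_ecl`,
`Khovanskii.eclSubfield`, `Khovanskii.ecl_ecl`, `Khovanskii.mem_ecl_of_isRoot`; they are
specialised, not restated.

## References

* [Kirby2010EAEF] J. Kirby, *Exponential algebraicity in exponential fields*, Bull. LMS 42 (2010)
  879–890 = arXiv:0810.4285, §3 (Def. 3.1–3.2, Lemma 3.3, Remark 3.4), §7 (proof of Prop. 7.1).
* [Zilber2005PseudoExp] B. Zilber, *Pseudo-exponentiation on algebraically closed fields of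
  characteristic zero*, APAL 132 (2005), Lemma 5.12.
-/

namespace Literature.NumberTheory.Transcendental

open MvPolynomial

/-! ### The bridge -/

/-- **Bridge lemma.** `IsExpAlgebraic a` is membership in the tree's exponential-algebraic
closure of `∅` in `ℂ_exp`: the integer-coefficient condition is membership in
`Subring.closure ∅ = ⊥` (`Subring.closure_empty`, `Subring.mem_bot`), the E-ring exponential of
`ℂ` is `Complex.exp` and `expPDeriv` is the chain-rule derivative, both by `rfl`.
[cite: Kirby2010EAEF, §3 Def. 3.2] -/
theorem isExpAlgebraic_iff_mem_ecl_empty {a : ℂ} : IsExpAlgebraic a ↔ a ∈ ecl (∅ : Set ℂ) := by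
  have hc : ∀ x : ℂ, x ∈ Subring.closure (∅ : Set ℂ) ↔ ∃ c : ℤ, (c : ℂ) = x := by
    intro x
    rw [Subring.closure_empty, Subring.mem_bot]
  constructor
  · rintro ⟨m, z, f, hz, hcoeff, heval, hdet⟩
    exact ⟨m, z, f, hz, fun k mo => (hc _).mpr (hcoeff k mo), heval, hdet⟩
  · rintro ⟨m, z, f, hz, hcoeff, heval, hdet⟩
    exact ⟨m, z, f, hz, fun k mo => (hc _).mp (hcoeff k mo), heval, hdet⟩

/-- `E = ecl(∅)` in `ℂ_exp` (set form of the bridge). [cite: Kirby2010EAEF, §3 Def. 3.2] -/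
theorem expAlgebraicNumbers_eq_ecl_empty : expAlgebraicNumbers = ecl (∅ : Set ℂ) :=
  Set.ext fun _ => isExpAlgebraic_iff_mem_ecl_empty

/-- `{a | IsExpAlgebraic a} = ecl ∅` (the form requested by route DiophantineCore).
[cite: Kirby2010EAEF, §3 Def. 3.2] -/
theorem setOf_isExpAlgebraic_eq_ecl_empty : {a : ℂ | IsExpAlgebraic a} = ecl (∅ : Set ℂ) :=
  expAlgebraicNumbers_eq_ecl_empty

/-- Tuple form of the bridge, in the shape of the route hypotheses (`∀ i, IsExpAlgebraic (x i)`)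
and of Kirby's countable core statement `schanuelConjecture_iff_ecl_empty`
(`∀ i, x i ∈ ecl ∅`). [cite: Kirby2010EAEF, §3 Def. 3.2] -/
theorem forall_isExpAlgebraic_iff {n : ℕ} (x : Fin n → ℂ) :
    (∀ i, IsExpAlgebraic (x i)) ↔ ∀ i, x i ∈ ecl (∅ : Set ℂ) :=
  forall_congr' fun _ => isExpAlgebraic_iff_mem_ecl_empty

/-- `E ⊆ ecl C` for every parameter set `C ⊆ ℂ` (`ecl` is monotone, Kirby Lemma 3.3).
[cite: Kirby2010EAEF, §3 Lemma 3.3] -/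
theorem IsExpAlgebraic.mem_ecl {a : ℂ} (ha : IsExpAlgebraic a) (C : Set ℂ) : a ∈ ecl C :=
  ecl_mono (Set.empty_subset C) (isExpAlgebraic_iff_mem_ecl_empty.mp ha)

/-- `E` is `ecl`-closed: `ecl E = E` (idempotence of `ecl`, Kirby Lemma 3.3; tree
`Khovanskii.ecl_ecl`). [cite: Kirby2010EAEF, §3 Lemma 3.3] -/
theorem ecl_expAlgebraicNumbers : ecl expAlgebraicNumbers = expAlgebraicNumbers := by
  rw [expAlgebraicNumbers_eq_ecl_empty, Khovanskii.ecl_ecl]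

/-! ### `E` is an E-subfield of `ℂ` -/

/-- `E` is the carrier of the tree's subfield `Khovanskii.eclSubfield ∅` of `ℂ` (Kirby 2010,
Lemma 3.3: "the closure of any subset is … an E-subfield"); no new bundled object is introduced.
[cite: Kirby2010EAEF, §3 Lemma 3.3] -/
theorem coe_eclSubfield_empty :
    ((Khovanskii.eclSubfield (∅ : Set ℂ) : Subfield ℂ) : Set ℂ) = expAlgebraicNumbers :=
  expAlgebraicNumbers_eq_ecl_empty.symm

/-- Membership in the subfield `Khovanskii.eclSubfield ∅` is `IsExpAlgebraic`.
[cite: Kirby2010EAEF, §3 Lemma 3.3] -/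
theorem mem_eclSubfield_empty_iff {a : ℂ} :
    a ∈ Khovanskii.eclSubfield (∅ : Set ℂ) ↔ IsExpAlgebraic a :=
  isExpAlgebraic_iff_mem_ecl_empty.symm

namespace IsExpAlgebraic

/-- `E` is closed under addition. [cite: Kirby2010EAEF, §3 Lemma 3.3] -/
theorem add {a b : ℂ} (ha : IsExpAlgebraic a) (hb : IsExpAlgebraic b) : IsExpAlgebraic (a + b) :=
  mem_eclSubfield_empty_iff.mp
    (add_mem (mem_eclSubfield_empty_iff.mpr ha) (mem_eclSubfield_empty_iff.mpr hb))

/-- `E` is closed under negation. [cite: Kirby2010EAEF, §3 Lemma 3.3] -/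
theorem neg {a : ℂ} (ha : IsExpAlgebraic a) : IsExpAlgebraic (-a) :=
  mem_eclSubfield_empty_iff.mp (neg_mem (mem_eclSubfield_empty_iff.mpr ha))

/-- `E` is closed under subtraction. [cite: Kirby2010EAEF, §3 Lemma 3.3] -/
theorem sub {a b : ℂ} (ha : IsExpAlgebraic a) (hb : IsExpAlgebraic b) : IsExpAlgebraic (a - b) :=
  mem_eclSubfield_empty_iff.mp
    (sub_mem (mem_eclSubfield_empty_iff.mpr ha) (mem_eclSubfield_empty_iff.mpr hb))

/-- `E` is closed under multiplication. [cite: Kirby2010EAEF, §3 Lemma 3.3] -/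
theorem mul {a b : ℂ} (ha : IsExpAlgebraic a) (hb : IsExpAlgebraic b) : IsExpAlgebraic (a * b) :=
  mem_eclSubfield_empty_iff.mp
    (mul_mem (mem_eclSubfield_empty_iff.mpr ha) (mem_eclSubfield_empty_iff.mpr hb))

/-- `E` is closed under inversion. [cite: Kirby2010EAEF, §3 Lemma 3.3] -/
theorem inv {a : ℂ} (ha : IsExpAlgebraic a) : IsExpAlgebraic a⁻¹ :=
  mem_eclSubfield_empty_iff.mp (inv_mem (mem_eclSubfield_empty_iff.mpr ha))

/-- `E` is closed under division. [cite: Kirby2010EAEF, §3 Lemma 3.3] -/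
theorem div {a b : ℂ} (ha : IsExpAlgebraic a) (hb : IsExpAlgebraic b) : IsExpAlgebraic (a / b) :=
  mem_eclSubfield_empty_iff.mp
    (div_mem (mem_eclSubfield_empty_iff.mpr ha) (mem_eclSubfield_empty_iff.mpr hb))

/-- `E` is closed under natural powers. [cite: Kirby2010EAEF, §3 Lemma 3.3] -/
theorem pow {a : ℂ} (ha : IsExpAlgebraic a) (n : ℕ) : IsExpAlgebraic (a ^ n) :=
  mem_eclSubfield_empty_iff.mp (pow_mem (mem_eclSubfield_empty_iff.mpr ha) n)

/-- `E` is closed under integer powers. [cite: Kirby2010EAEF, §3 Lemma 3.3] -/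
theorem zpow {a : ℂ} (ha : IsExpAlgebraic a) (n : ℤ) : IsExpAlgebraic (a ^ n) :=
  mem_eclSubfield_empty_iff.mp (zpow_mem (mem_eclSubfield_empty_iff.mpr ha) n)

/-- `E` is closed under the exponential (Kirby Lemma 3.3: `ecl C` is an E-subfield; tree
`Khovanskii.exp_mem_ecl`). [cite: Kirby2010EAEF, §3 Lemma 3.3] -/
theorem exp {a : ℂ} (ha : IsExpAlgebraic a) : IsExpAlgebraic (Complex.exp a) := by
  rw [isExpAlgebraic_iff_mem_ecl_empty] at ha ⊢
  exact Khovanskii.exp_mem_ecl ha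

/-- `E` contains all logarithms of its elements: if `exp a ∈ E` then `a ∈ E` (`a` solves the
one-unknown Khovanskii system `Y − exp a = 0`, `∂/∂x = Y ≠ 0`, over `E`, and `ecl E = E`).
[cite: Kirby2010EAEF, §3 Lemma 3.3] -/
theorem of_exp {a : ℂ} (ha : IsExpAlgebraic (Complex.exp a)) : IsExpAlgebraic a := by
  classical
  rw [isExpAlgebraic_iff_mem_ecl_empty] at ha ⊢
  rw [← Khovanskii.ecl_ecl (∅ : Set ℂ), Khovanskii.mem_ecl_iff]
  refine ⟨Unit, inferInstance, inferInstance, fun _ => a,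
    fun _ => X (Sum.inr ()) - C (Complex.exp a), ?_, (), rfl⟩
  refine Khovanskii.IsSol.single a _ ?_ ?_ ?_
  · exact sub_mem (Khovanskii.X_mem_polyOver _ _)
      (Khovanskii.C_mem_polyOver (Subring.subset_closure ha))
  · simp [Khovanskii.kpt]
  · simp [Khovanskii.ePD, Khovanskii.kpt, pderiv_X, Complex.exp_ne_zero]

/-- `E` is closed under the principal logarithm (for `a = 0`, `log 0 = 0 ∈ E`).
[cite: Kirby2010EAEF, §3 Lemma 3.3] -/
theorem log {a : ℂ} (ha : IsExpAlgebraic a) : IsExpAlgebraic (Complex.log a) := by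
  by_cases h0 : a = 0
  · rw [h0, Complex.log_zero]
    exact isExpAlgebraic_zero
  · exact of_exp (by rwa [Complex.exp_log h0])

/-- `E` is relatively algebraically closed in `ℂ`: a root of a non-zero polynomial with
coefficients in `E` lies in `E` (Kirby 2010, §7, proof of Prop. 7.1; tree
`Khovanskii.mem_ecl_of_isRoot`). [cite: Kirby2010EAEF, §7 (proof of Prop. 7.1)] -/
theorem of_isRoot {a : ℂ} {p : Polynomial ℂ} (hp0 : p ≠ 0)
    (hcoef : ∀ n, IsExpAlgebraic (p.coeff n)) (hroot : p.IsRoot a) : IsExpAlgebraic a := by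
  rw [isExpAlgebraic_iff_mem_ecl_empty]
  exact Khovanskii.mem_ecl_of_isRoot hp0
    (fun n => isExpAlgebraic_iff_mem_ecl_empty.mp (hcoef n)) hroot

end IsExpAlgebraic

/-- Rational numbers are exponentially algebraic. [cite: Kirby2010EAEF, §3 Lemma 3.3] -/
theorem isExpAlgebraic_ratCast (q : ℚ) : IsExpAlgebraic (q : ℂ) :=
  mem_eclSubfield_empty_iff.mp (SubfieldClass.ratCast_mem (Khovanskii.eclSubfield (∅ : Set ℂ)) q)

/-- Algebraic numbers are exponentially algebraic (`E` is a relatively algebraically closed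
subfield of `ℂ` containing `ℚ`). [cite: Kirby2010EAEF, §7 (proof of Prop. 7.1)] -/
theorem IsExpAlgebraic.of_isAlgebraic {a : ℂ} (ha : IsAlgebraic ℚ a) : IsExpAlgebraic a := by
  obtain ⟨p, hp0, hpa⟩ := ha
  refine IsExpAlgebraic.of_isRoot (p := p.map (algebraMap ℚ ℂ)) ?_ ?_ ?_
  · exact (Polynomial.map_ne_zero_iff (algebraMap ℚ ℂ).injective).mpr hp0
  · intro n
    rw [Polynomial.coeff_map, eq_ratCast]
    exact isExpAlgebraic_ratCast _
  · rw [Polynomial.IsRoot, Polynomial.eval_map, ← Polynomial.aeval_def, hpa]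

/-! ### The classical constants -/

/-- `πi ∈ E`: `z = πi` solves `e^z + 1 = 0` with `∂/∂z = e^z = −1 ≠ 0`.
[cite: Kirby2010EAEF, §3 Def. 3.1 and Remark 3.4] -/
theorem isExpAlgebraic_pi_mul_I : IsExpAlgebraic (Real.pi * Complex.I) := by
  classical
  refine IsExpAlgebraic.of_solution (m := 1) (z := fun _ => Real.pi * Complex.I)
    (f := fun _ => X (Sum.inr 0) + 1) ?_ ?_ ?_ 0
  · intro k mo
    rw [coeff_add, coeff_X, coeff_one]
    split_ifs
    · exact ⟨2, by push_cast; ring⟩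
    · exact ⟨1, by push_cast; ring⟩
    · exact ⟨1, by push_cast; ring⟩
    · exact ⟨0, by push_cast; ring⟩
  · intro k
    simp [Complex.exp_pi_mul_I]
  · have h1 : ∀ j : Fin 1, MvPolynomial.eval
        (Sum.elim (fun _ => (Real.pi * Complex.I : ℂ))
          (Complex.exp ∘ fun _ => (Real.pi * Complex.I : ℂ)))
        (pderiv (Sum.inl j) (X (Sum.inr 0) + 1) +
          X (Sum.inr j) * pderiv (Sum.inr j) (X (Sum.inr 0) + 1) :
            MvPolynomial (Fin 1 ⊕ Fin 1) ℂ) = -1 := by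
      intro j
      simp [Subsingleton.elim j 0, pderiv_X, Complex.exp_pi_mul_I]
    rw [Matrix.det_unique, Matrix.of_apply, h1]
    norm_num

/-- `i ∈ E` (`i` is algebraic: a root of `X² + 1`).
[cite: Kirby2010EAEF, §7 (proof of Prop. 7.1)] -/
theorem isExpAlgebraic_I : IsExpAlgebraic Complex.I := by
  refine IsExpAlgebraic.of_isRoot (p := Polynomial.X ^ 2 + 1) ?_ ?_ ?_
  · intro h
    have := congrArg (Polynomial.eval 0) h
    simp at this
  · intro n
    rw [Polynomial.coeff_add, Polynomial.coeff_X_pow, Polynomial.coeff_one]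
    split_ifs <;> first
      | exact (isExpAlgebraic_one.add isExpAlgebraic_one)
      | simpa using isExpAlgebraic_one
      | simpa using isExpAlgebraic_zero
  · simp [Polynomial.IsRoot]

/-- `π ∈ E` (`π = πi · i⁻¹`). [cite: Kirby2010EAEF, §3 Remark 3.4] -/
theorem isExpAlgebraic_pi : IsExpAlgebraic (Real.pi : ℂ) := by
  have h := isExpAlgebraic_pi_mul_I.mul isExpAlgebraic_I.inv
  rwa [mul_inv_cancel_right₀ Complex.I_ne_zero] at h

/-- `e = exp 1 ∈ E`. [cite: Kirby2010EAEF, §3 Lemma 3.3] -/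
theorem isExpAlgebraic_exp_one : IsExpAlgebraic (Complex.exp 1) :=
  isExpAlgebraic_one.exp

/-- Logarithms of algebraic numbers lie in `E`. [cite: Kirby2010EAEF, §3 Lemma 3.3] -/
theorem isExpAlgebraic_log_of_isAlgebraic {a : ℂ} (ha : IsAlgebraic ℚ a) :
    IsExpAlgebraic (Complex.log a) :=
  (IsExpAlgebraic.of_isAlgebraic ha).log

/-- `log n ∈ E` for every natural number `n`. [cite: Kirby2010EAEF, §3 Lemma 3.3] -/
theorem isExpAlgebraic_log_natCast (n : ℕ) : IsExpAlgebraic (Complex.log n) :=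
  (isExpAlgebraic_natCast n).log

/-- `√2 ∈ E` (`√2` is algebraic: a root of `X² − 2`; the algebraicity itself is the tree's
`Literature.Barriers.Schanuel.isAlgebraic_sqrt_two`, re-proved inline here to keep the import
cone inside `Literature/NumberTheory`). [cite: Kirby2010EAEF, §7 (proof of Prop. 7.1)] -/
theorem isExpAlgebraic_sqrt_two : IsExpAlgebraic ((Real.sqrt 2 : ℝ) : ℂ) := by
  refine IsExpAlgebraic.of_isAlgebraic ⟨Polynomial.X ^ 2 - Polynomial.C 2, ?_, ?_⟩
  · intro h
    have := congrArg (Polynomial.eval 0) h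
    simp at this
  · have h2 : (((Real.sqrt 2 : ℝ) : ℂ)) ^ 2 = 2 := by
      rw [← Complex.ofReal_pow, Real.sq_sqrt (by norm_num : (0 : ℝ) ≤ 2)]
      norm_num
    simp [h2]

/-- **The classical open pairs of Schanuel's conjecture are pairs from `E`**: `(1, πi)`
(algebraic independence of `e` and `π`), `(1, e)` (`e` and `e^e`), `(log 2, √2·log 2)` (`log 2`
and `2^{√2}`), `(πi, log 2)` (`π` and `log 2`). [cite: Kirby2010EAEF, §3 Remark 3.4] -/
theorem isExpAlgebraic_classicalPairs :
    (∀ i, IsExpAlgebraic (![(1 : ℂ), Real.pi * Complex.I] i)) ∧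
    (∀ i, IsExpAlgebraic (![(1 : ℂ), Complex.exp 1] i)) ∧
    (∀ i, IsExpAlgebraic (![Complex.log 2, (Real.sqrt 2 : ℝ) * Complex.log 2] i)) ∧
    (∀ i, IsExpAlgebraic (![Real.pi * Complex.I, Complex.log 2] i)) := by
  have hlog2 : IsExpAlgebraic (Complex.log 2) := by
    simpa using isExpAlgebraic_log_natCast 2
  refine ⟨?_, ?_, ?_, ?_⟩ <;> intro i <;> fin_cases i
  · exact isExpAlgebraic_one
  · exact isExpAlgebraic_pi_mul_I
  · exact isExpAlgebraic_one
  · exact isExpAlgebraic_exp_one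
  · exact hlog2
  · exact isExpAlgebraic_sqrt_two.mul hlog2
  · exact isExpAlgebraic_pi_mul_I
  · exact hlog2

/-! ### Countability -/

/-- **`E` is countable** ("there are only countably many exponentially algebraic numbers",
Kirby 2010, Remark 3.4; Zilber 2005, Lemma 5.12), from the tree's discharge of the countable
closure property of `ℂ_exp`. [cite: Kirby2010EAEF, §3 Remark 3.4] -/
theorem countable_expAlgebraicNumbers : expAlgebraicNumbers.Countable := by
  rw [expAlgebraicNumbers_eq_ecl_empty]
  exact hasCountableClosureProperty_complex_holds ∅ Set.countable_empty

/-- `{a | IsExpAlgebraic a}` is countable. [cite: Kirby2010EAEF, §3 Remark 3.4] -/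
theorem countable_setOf_isExpAlgebraic : {a : ℂ | IsExpAlgebraic a}.Countable :=
  countable_expAlgebraicNumbers

/-- `E ≠ ℂ`: exponentially transcendental numbers exist (by counting; no explicit one is known,
Kirby 2010, Remark 3.4). [cite: Kirby2010EAEF, §3 Remark 3.4] -/
theorem exists_not_isExpAlgebraic : ∃ a : ℂ, ¬IsExpAlgebraic a := by
  by_contra h
  exact not_countable_complex
    (countable_expAlgebraicNumbers.mono fun a _ => not_not.mp (not_exists.mp h a))

end Literature.NumberTheory.Transcendental
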